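import Mathlib
import Summits.ValiantsHypothesis.ValiantsHypothesis.Theorems.LacunarySymmetroidMatrixDescartesTieLawInduction
import HarnessLib

/-!
# ValiantsHypothesis / LacunarySymmetroid — crux `MatrixDescartes` (stmt-ValiantsHypothesis-18050, V1), LINE (A) «product_plus_one»:
# the TIE LAW, kernel path Stage 2, part 7 — theorem (ii) and `theorem tieLaw : TieLaw.Statement`

From theorem (i) (`card_roots_MF_tieSector`, pairwise distinct positive roots `σ_f`) to the tie law for ALL positive data
(pen val-idea-25 g8, HOME NOTE §45.4 (ii)): the positive root `σ_f` of each well exists (`exists_pos_root_gPoly`, IVT); perturb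
`σ_f ↦ σ_f + s·f` (pairwise distinct for all small `s > 0`) keeping `γ_f`, `w_f` and putting `β_f(s) = γ_f σ_f(s)^c + σ_f(s)^a`
(so `β_f(0) = β_f`); the coefficients of `M` move continuously, so small disjoint discs around the positive real roots of `M` at
`s = 0` keep their root counts (`card_roots_filter_eventually_eq` with `V` = union of those discs ⊂ S′), whence
`#{positive real roots of M, with multiplicity} ≤ #{roots of M_s in S′} = 2T − 1`.  Finally the real root multiset embeds in the
complex one (`Polynomial.map_roots_le`), giving `theorem tieLaw : TieLaw.Statement` — the statement typed in `…TieLawDefs`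
(✓ p743170, `@[conjecture]` there) is now a kernel theorem.
HONEST FRAMING: this proves the TIE LAW ((WELLS-GEN″)/(CL-1) at the tie, all coprime shapes, all T) as a free-standing theorem under
18050; it closes NO registered stub of LINE (A) (`stub_oneChangeFloorK3` etc. untouched; sorries of the line 4 → 4); `MatrixDescartes`
OPEN; `VP ≠ VNP` is NOT proved.  No definitions, no named facts.
-/

set_option linter.dupNamespace false

namespace Summit.ValiantsHypothesis.ValiantsHypothesis.Theorems.LacunarySymmetroidMatrixDescartes

namespace TieLaw

open Polynomial Filter Topology

section Main

variable {a b : ℕ}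

/-! ### The positive root of a well -/

/-- Every well has a positive root `σ` of `g = γX^c + X^a − β` (`β, γ > 0`, `0 < a`, `0 < c`). -/
theorem exists_pos_root_gPoly (ha : 0 < a) {c : ℕ} (hc : 0 < c) {β γ : ℝ} (hβ : 0 < β) (hγ : 0 < γ) :
    ∃ σ : ℝ, 0 < σ ∧ (gPoly a c β γ).eval σ = 0 := by
  have hev : ∀ u : ℝ, (gPoly a c β γ).eval u = γ * u ^ c + u ^ a - β := fun u => by
    simp [gPoly, eval_add, eval_sub, eval_mul, eval_pow, eval_C, eval_X]
  set t₀ : ℝ := 1 + β / γ with ht₀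
  have ht₀1 : 1 ≤ t₀ := by rw [ht₀]; have := div_pos hβ hγ; linarith
  have h0 : (gPoly a c β γ).eval 0 < 0 := by
    rw [hev, zero_pow hc.ne', zero_pow ha.ne']
    linarith
  have h1 : 0 ≤ (gPoly a c β γ).eval t₀ := by
    rw [hev]
    have hp : t₀ ≤ t₀ ^ c := le_self_pow₀ ht₀1 hc.ne'
    have hq : 0 ≤ t₀ ^ a := by positivity
    have : γ * t₀ = γ + β := by rw [ht₀]; field_simp
    nlinarith
  obtain ⟨σ, hσmem, hσ⟩ := intermediate_value_Icc (show (0 : ℝ) ≤ t₀ by linarith)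
    (gPoly a c β γ).continuous.continuousOn (Set.mem_Icc.2 ⟨h0.le, h1⟩)
  have hσ0 : σ ≠ 0 := by
    rintro rfl
    have hσ' : (gPoly a c β γ).eval 0 = 0 := hσ
    rw [hσ'] at h0
    exact lt_irrefl _ h0
  exact ⟨σ, lt_of_le_of_ne hσmem.1 (Ne.symm hσ0), hσ⟩

/-! ### Coefficientwise continuity of the well polynomials in `β` -/

/-- Products of coefficientwise-continuous families are coefficientwise continuous. -/
theorem coeff_continuous_mul {p q : ℝ → ℝ[X]} (hp : ∀ k, Continuous fun s => (p s).coeff k)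
    (hq : ∀ k, Continuous fun s => (q s).coeff k) : ∀ k, Continuous fun s => (p s * q s).coeff k := by
  intro k
  simp only [coeff_mul]
  exact continuous_finsetSum _ fun x _ => (hp x.1).mul (hq x.2)

/-- Finite products of coefficientwise-continuous families are coefficientwise continuous. -/
theorem coeff_continuous_prod {ι : Type*} [DecidableEq ι] (F : Finset ι) (p : ι → ℝ → ℝ[X])
    (hp : ∀ i ∈ F, ∀ k, Continuous fun s => (p i s).coeff k) :
    ∀ k, Continuous fun s => (∏ i ∈ F, p i s).coeff k := by
  induction F using Finset.induction_on with
  | empty =>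
    intro k
    simp only [Finset.prod_empty, coeff_one]
    exact continuous_const
  | @insert i F hi ih =>
    intro k
    simp only [Finset.prod_insert hi]
    exact coeff_continuous_mul (hp i (Finset.mem_insert_self _ _))
      (ih fun j hj => hp j (Finset.mem_insert_of_mem hj)) k

/-- `n` with moving `β` is coefficientwise continuous. -/
theorem coeff_continuous_nPoly (a b c : ℕ) {βf : ℝ → ℝ} (hβ : Continuous βf) (γ : ℝ) :
    ∀ k, Continuous fun s => (nPoly a b c (βf s) γ).coeff k := by
  intro k
  simp only [nPoly, coeff_sub, coeff_C_mul, coeff_X_pow, coeff_C]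
  by_cases h1 : k = c
  · by_cases h2 : k = 0
    · simp only [if_pos h1, if_pos h2]; fun_prop
    · simp only [if_pos h1, if_neg h2]; fun_prop
  · by_cases h2 : k = 0
    · simp only [if_neg h1, if_pos h2]; fun_prop
    · simp only [if_neg h1, if_neg h2]; fun_prop

/-- `m` with moving `β` is coefficientwise continuous. -/
theorem coeff_continuous_mPoly (c : ℕ) {βf : ℝ → ℝ} (hβ : Continuous βf) (γ : ℝ) :
    ∀ k, Continuous fun s => (mPoly c (βf s) γ).coeff k := by
  intro k
  simp only [mPoly, coeff_add, coeff_C_mul, coeff_X_pow, coeff_C]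
  by_cases h1 : k = c
  · by_cases h2 : k = 0
    · simp only [if_pos h1, if_pos h2]; fun_prop
    · simp only [if_pos h1, if_neg h2]; fun_prop
  · by_cases h2 : k = 0
    · simp only [if_neg h1, if_pos h2]; fun_prop
    · simp only [if_neg h1, if_neg h2]; fun_prop

/-- `q` with moving `β` is coefficientwise continuous. -/
theorem coeff_continuous_qPoly (a c : ℕ) {βf : ℝ → ℝ} (hβ : Continuous βf) (γ : ℝ) :
    ∀ k, Continuous fun s => (qPoly a c (βf s) γ).coeff k := by
  have hm := coeff_continuous_mPoly c hβ γ
  have h1 := coeff_continuous_mul hm hm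
  have hconst : ∀ k, Continuous fun _ : ℝ => (C (2 * Real.cos (Real.pi * a / c)) * X ^ a : ℝ[X]).coeff k :=
    fun k => continuous_const
  have h2 := coeff_continuous_mul hconst hm
  intro k
  have e : ∀ s, qPoly a c (βf s) γ = mPoly c (βf s) γ * mPoly c (βf s) γ -
      C (2 * Real.cos (Real.pi * a / c)) * X ^ a * mPoly c (βf s) γ + X ^ (2 * a) := fun s => by
    rw [qPoly, pow_two]
  simp only [e, coeff_add, coeff_sub]
  exact ((h1 k).sub (h2 k)).add continuous_const

/-- `M_F` with moving `β` is coefficientwise continuous. -/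
theorem coeff_continuous_MF {ι : Type*} [DecidableEq ι] (a b : ℕ) (F : Finset ι) {βf : ι → ℝ → ℝ}
    (hβ : ∀ f, Continuous (βf f)) (γ w : ι → ℝ) :
    ∀ k, Continuous fun s => (MF a b F (fun f => βf f s) γ w).coeff k := by
  intro k
  simp only [MF, finsetSum_coeff]
  refine continuous_finsetSum _ fun f _ => ?_
  have h1 : ∀ k, Continuous fun s : ℝ => (C (w f) * nPoly a b (a + b) (βf f s) (γ f)).coeff k := by
    intro k
    simp only [coeff_C_mul]
    exact continuous_const.mul (coeff_continuous_nPoly a b (a + b) (hβ f) (γ f) k)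
  exact coeff_continuous_mul h1 (coeff_continuous_prod (F.erase f) (fun f' s => qPoly a (a + b) (βf f' s) (γ f'))
    fun f' _ => coeff_continuous_qPoly a (a + b) (hβ f') (γ f')) k

/-! ### Theorem (ii): positive real roots -/

/-- The perturbed roots `σ_f + s·f` are pairwise distinct for all small `s > 0`. -/
theorem eventually_injOn_perturb {T : ℕ} (σ : Fin T → ℝ) :
    ∀ᶠ s in 𝓝[>] (0 : ℝ), Set.InjOn (fun f : Fin T => σ f + s * (f : ℕ)) (Finset.univ : Finset (Fin T)) := by
  have hpair : ∀ p ∈ (Finset.univ : Finset (Fin T)).offDiag, ∀ᶠ s in 𝓝[>] (0 : ℝ),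
      σ p.1 + s * (p.1 : ℕ) ≠ σ p.2 + s * (p.2 : ℕ) := by
    intro p hp
    have hne : p.1 ≠ p.2 := (Finset.mem_offDiag.1 hp).2.2
    have hne' : ((p.1 : ℕ) : ℝ) ≠ ((p.2 : ℕ) : ℝ) := by
      intro h
      exact hne (Fin.ext (by exact_mod_cast h))
    set s₀ := (σ p.2 - σ p.1) / (((p.1 : ℕ) : ℝ) - ((p.2 : ℕ) : ℝ)) with hs₀
    have hkey : ∀ s : ℝ, σ p.1 + s * (p.1 : ℕ) = σ p.2 + s * (p.2 : ℕ) → s = s₀ := by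
      intro s h
      rw [hs₀, eq_div_iff (sub_ne_zero.2 hne')]
      linarith
    by_cases h0 : s₀ = 0
    · filter_upwards [self_mem_nhdsWithin] with s hs h
      exact (ne_of_gt hs) (h0 ▸ hkey s h)
    · filter_upwards [(eventually_ne_nhds (Ne.symm h0) : ∀ᶠ s in 𝓝 (0:ℝ), s ≠ s₀).filter_mono nhdsWithin_le_nhds]
        with s hs h
      exact hs (hkey s h)
  filter_upwards [(Finset.univ.offDiag.eventually_all).2 hpair] with s hs f _ g _ hfg
  by_contra hne
  exact hs (f, g) (Finset.mem_offDiag.2 ⟨Finset.mem_univ _, Finset.mem_univ _, hne⟩) hfg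

open Classical in
/-- **Theorem (ii) of the tie law** (complex form): for `0 < a < b` and all positive data, `tieM` has at most `2T − 1` roots,
counted with multiplicity, on the positive real axis. -/
theorem card_roots_tieM_posReal_le (ha : 0 < a) (hab : a < b) {T : ℕ} (β γ w : Fin T → ℝ) (hβ : ∀ f, 0 < β f)
    (hγ : ∀ f, 0 < γ f) (hw : ∀ f, 0 < w f) :
    (((tieM a b β γ w).map (algebraMap ℝ ℂ)).roots.filter (fun z => z.im = 0 ∧ 0 < z.re)).card ≤ 2 * T - 1 := by
  rcases Nat.eq_zero_or_pos T with hT | hT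
  · subst hT
    have : tieM a b β γ w = 0 := by simp [tieM]
    rw [this, Polynomial.map_zero, roots_zero, Multiset.filter_zero, Multiset.card_zero]
  set c := a + b with hc
  have hcpos : 0 < c := by omega
  have hc2 : 2 < c := by omega
  have huniv : (Finset.univ : Finset (Fin T)).Nonempty := Finset.univ_nonempty_iff.2 ⟨⟨0, hT⟩⟩
  -- the positive roots σ_f and the perturbation
  choose σ hσpos hσroot using fun f : Fin T => exists_pos_root_gPoly ha hcpos (hβ f) (hγ f)
  have hβσ : ∀ f, β f = γ f * σ f ^ c + σ f ^ a := fun f => by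
    have h := hσroot f
    simp [gPoly, eval_add, eval_sub, eval_mul, eval_pow, eval_C, eval_X] at h
    linarith
  set σs : ℝ → Fin T → ℝ := fun s f => σ f + s * (f : ℕ) with hσs
  set βs : ℝ → Fin T → ℝ := fun s f => γ f * σs s f ^ c + σs s f ^ a with hβs
  have hβs0 : βs 0 = β := by
    funext f
    simp [hβs, hσs, hβσ]
  have hβscont : ∀ f, Continuous fun s => βs s f := fun f => by
    simp only [hβs, hσs]
    fun_prop
  -- the complex family
  set P : ℝ → ℂ[X] := fun s => (MF a b Finset.univ (βs s) γ w).map (algebraMap ℝ ℂ) with hP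
  have hP0 : P 0 = (tieM a b β γ w).map (algebraMap ℝ ℂ) := by
    simp only [hP, hβs0, tieM_eq_MF]
  set N := c * (2 * T - 1) with hN
  have hcardT : (Finset.univ : Finset (Fin T)).card = T := by simp
  have hdeg : ∀ s, (P s).natDegree ≤ N := fun s => by
    rw [hP]
    refine (natDegree_map_le).trans ?_
    have := natDegree_MF_le hab (Finset.univ : Finset (Fin T)) (βs s) γ w
    rwa [hcardT] at this
  have hlead : (P 0).coeff N ≠ 0 := by
    rw [hP, coeff_map]
    have := coeff_MF_top_pos hab (Finset.univ : Finset (Fin T)) huniv (βs 0) γ w (fun f _ => hγ f) (fun f _ => hw f)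
    rw [hcardT] at this
    simp only [Complex.coe_algebraMap, ne_eq, Complex.ofReal_eq_zero]
    exact this.ne'
  have hcont : ∀ k, ContinuousAt (fun s => (P s).coeff k) 0 := fun k => by
    have h := coeff_continuous_MF a b (Finset.univ : Finset (Fin T)) (βf := fun f s => βs s f) hβscont γ w k
    simp only [hP, coeff_map]
    exact (Complex.continuous_ofReal.comp h).continuousAt
  -- for small s > 0 theorem (i) applies
  have hcount : ∀ᶠ s in 𝓝[>] (0 : ℝ), ((P s).roots.filter (· ∈ tieSector c)).card = 2 * T - 1 := by
    filter_upwards [eventually_injOn_perturb σ, self_mem_nhdsWithin] with s hinj hs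
    have hs : 0 < s := hs
    have hσs_pos : ∀ f, 0 < σs s f := fun f => by
      simp only [hσs]; have := hσpos f; positivity
    have h := card_roots_MF_tieSector ha hab (Finset.univ : Finset (Fin T)) huniv (βs s) γ w (σs s)
      (fun f _ => by simp only [hβs]; have := hσs_pos f; have := hγ f; positivity) (fun f _ => hγ f) (fun f _ => hw f)
      (fun f _ => hσs_pos f)
      (fun f _ => by simp [gPoly, hβs, hc, eval_add, eval_sub, eval_mul, eval_pow, eval_C, eval_X]) hinj
    rw [hcardT] at h
    exact h
  -- discs around the positive real roots at s = 0
  set R₀ := (P 0).roots with hR₀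
  set S := R₀.toFinset with hS
  set Z := S.filter (fun z => z.im = 0 ∧ 0 < z.re) with hZ
  have hZS : ∀ z ∈ Z, z ∈ tieSector c := by
    intro z hz
    obtain ⟨-, hzim, hzre⟩ := Finset.mem_filter.1 hz
    have hzeq : z = (z.re : ℂ) := Complex.ext (by simp) (by simp [hzim])
    have hsin : 0 < Real.sin (Real.pi / c) := by
      apply Real.sin_pos_of_pos_of_lt_pi (by positivity)
      rw [div_lt_iff₀ (by exact_mod_cast hcpos)]
      have : (1 : ℝ) < c := by exact_mod_cast (show 1 < c by omega)
      nlinarith [Real.pi_pos]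
    rw [mem_tieSector, hzeq, im_ofReal_mul_rot, im_ofReal_mul_rot, Real.sin_neg]
    exact ⟨mul_pos hzre hsin, by nlinarith⟩
  obtain ⟨ρ₁, hρ₁, hρ₁le⟩ := exists_pos_forall_le S.offDiag (fun zz => ‖zz.1 - zz.2‖ / 3) (fun zz hzz => by
    have h := (Finset.mem_offDiag.1 hzz).2.2
    have : 0 < ‖zz.1 - zz.2‖ := norm_pos_iff.2 (sub_ne_zero.2 h)
    positivity)
  have hballs : ∀ z ∈ Z, ∃ r : ℝ, 0 < r ∧ ∀ w, ‖w - z‖ < r → w ∈ tieSector c := by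
    intro z hz
    obtain ⟨r, hr, hball⟩ := Metric.isOpen_iff.1 (isOpen_tieSector c) z (hZS z hz)
    exact ⟨r, hr, fun w hw => hball (by simpa [Metric.mem_ball, dist_eq_norm] using hw)⟩
  choose! rZ hrZ hballZ using hballs
  obtain ⟨ρ₂, hρ₂, hρ₂le⟩ := exists_pos_forall_le Z rZ hrZ
  set ρ := min ρ₁ ρ₂ with hρdef
  have hρ : 0 < ρ := lt_min hρ₁ hρ₂
  have hsep : ∀ z ∈ S, ∀ z' ∈ S, z ≠ z' → 3 * ρ ≤ ‖z - z'‖ := by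
    intro z hz z' hz' hne
    have h := hρ₁le (z, z') (Finset.mem_offDiag.2 ⟨hz, hz', hne⟩)
    have : ρ ≤ ‖z - z'‖ / 3 := (min_le_left _ _).trans h
    linarith
  set V : Set ℂ := {w | ∃ z ∈ Z, ‖w - z‖ < ρ} with hV
  have hVS : V ⊆ tieSector c := by
    rintro w ⟨z, hz, hwz⟩
    exact hballZ z hz w (hwz.trans_le ((min_le_right _ _).trans (hρ₂le z hz)))
  -- side information: centres are inside V, all other roots of P 0 are far from V
  have hside : ∀ z ∈ R₀, ∃ ρ' : ℝ, 0 < ρ' ∧ ∀ᶠ s in 𝓝[>] (0 : ℝ),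
      ∀ u ∈ (P s).roots, ‖u - z‖ < ρ' → (u ∈ V ↔ z ∈ V) := by
    intro z hz
    have hzS : z ∈ S := Multiset.mem_toFinset.2 hz
    refine ⟨ρ, hρ, Eventually.of_forall fun s u _ huz => ?_⟩
    by_cases hzZ : z ∈ Z
    · have hzV : z ∈ V := ⟨z, hzZ, by rw [sub_self, norm_zero]; exact hρ⟩
      exact iff_of_true ⟨z, hzZ, huz⟩ hzV
    · have hfar : ∀ z' ∈ Z, 3 * ρ ≤ ‖z - z'‖ := fun z' hz' =>
        hsep z hzS z' (Finset.mem_of_mem_filter z' hz') (fun h => hzZ (h ▸ hz'))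
      have hzV : z ∉ V := by
        rintro ⟨z', hz', hzz'⟩
        have := hfar z' hz'
        linarith
      have huV : u ∉ V := by
        rintro ⟨z', hz', huz'⟩
        have h3 := hfar z' hz'
        have : ‖z - z'‖ ≤ ‖u - z‖ + ‖u - z'‖ := by
          calc ‖z - z'‖ = ‖(u - z') - (u - z)‖ := by rw [show (u - z') - (u - z) = z - z' by ring]
            _ ≤ ‖u - z'‖ + ‖u - z‖ := norm_sub_le _ _
            _ = ‖u - z‖ + ‖u - z'‖ := add_comm _ _
        linarith
      exact iff_of_false huV hzV
  have hbook := card_roots_filter_eventually_eq (l := 𝓝[>] (0 : ℝ)) nhdsWithin_le_nhds hdeg hlead hcont V (· ∈ V)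
    hside
  -- roots of P 0 in V are exactly its positive real roots
  have hRV : R₀.filter (· ∈ V) = R₀.filter (fun z => z.im = 0 ∧ 0 < z.re) := by
    refine Multiset.filter_congr fun z hz => ?_
    have hzS : z ∈ S := Multiset.mem_toFinset.2 hz
    constructor
    · rintro ⟨z', hz', hzz'⟩
      have hz'S : z' ∈ S := Finset.mem_of_mem_filter z' hz'
      have : z = z' := by
        by_contra hne
        have := hsep z hzS z' hz'S hne
        linarith
      subst this
      exact (Finset.mem_filter.1 hz').2
    · intro h
      exact ⟨z, Finset.mem_filter.2 ⟨hzS, h⟩, by rw [sub_self, norm_zero]; exact hρ⟩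
  -- conclude along a small s > 0
  obtain ⟨s, hs1, hs2⟩ := (hbook.and hcount).exists
  rw [← hP0]
  calc (R₀.filter (fun z => z.im = 0 ∧ 0 < z.re)).card
      = (R₀.filter (· ∈ V)).card := by rw [hRV]
    _ = ((P s).roots.filter (· ∈ V)).card := hs1.symm
    _ ≤ ((P s).roots.filter (· ∈ tieSector c)).card :=
        Multiset.card_le_card (Multiset.monotone_filter_right _ fun u hu => hVS hu)
    _ = 2 * T - 1 := hs2

open Classical in
/-- Positive real roots of a real polynomial, counted with multiplicity, are at most its complex roots on the positive real
axis, counted with multiplicity. -/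
theorem card_roots_filter_pos_le_map (p : ℝ[X]) :
    (p.roots.filter (fun t => 0 < t)).card ≤
      (((p.map (algebraMap ℝ ℂ)).roots.filter (fun z => z.im = 0 ∧ 0 < z.re)).card) := by
  by_cases hp : p = 0
  · simp [hp]
  have hle : p.roots.map (algebraMap ℝ ℂ) ≤ (p.map (algebraMap ℝ ℂ)).roots :=
    map_roots_le ((Polynomial.map_ne_zero_iff (algebraMap ℝ ℂ).injective).2 hp)
  have h1 : (p.roots.filter (fun t => 0 < t)).card =
      ((p.roots.map (algebraMap ℝ ℂ)).filter (fun z => z.im = 0 ∧ 0 < z.re)).card := by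
    rw [Multiset.filter_map, Multiset.card_map]
    congr 1
    refine Multiset.filter_congr fun t _ => ?_
    simp [Function.comp, Complex.coe_algebraMap]
  rw [h1]
  exact Multiset.card_le_card (Multiset.filter_le_filter _ hle)

/-- **THE TIE LAW** (pen val-idea-25 g8, HOME NOTE §45; refereed PASS by val-idea-crit-1 g10 #356, val-idea-crit-2 g7, val-lit-p3 g22;
kernel proof val-lit-p3 g23): for coprime `1 ≤ a < b` and positive wells and weights, `M_T = Σ_f w_f n_f ∏_{f'≠f} q_{f'}` has at most
`2T − 1` positive roots counted with multiplicity.  This discharges the `@[conjecture]`-tagged `TieLaw.Statement` of `…TieLawDefs`.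
(`Nat.Coprime a b` is not used.) -/
theorem tieLaw : Statement := by
  intro a b ha hab _ T β γ w hβ hγ hw
  classical
  calc Multiset.card ((tieM a b β γ w).roots.filter (fun t => 0 < t))
      ≤ (((tieM a b β γ w).map (algebraMap ℝ ℂ)).roots.filter (fun z => z.im = 0 ∧ 0 < z.re)).card := by
        convert card_roots_filter_pos_le_map (tieM a b β γ w) using 2
    _ ≤ 2 * T - 1 := card_roots_tieM_posReal_le ha hab β γ w hβ hγ hw

end Main

end TieLaw

end Summit.ValiantsHypothesis.ValiantsHypothesis.Theorems.LacunarySymmetroidMatrixDescartes
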